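import Mathlib
import HarnessLib
import Literature.MathematicalPhysics.QuantumLattice.HubbardEffectiveActionCTTimeReversal
import Summits.HubbardSuperconductivity.HubbardSuperconductivity.Theorems.KLProgrammeKLRegimeEngineV8ExportUnroll

/-!
# Route `KLProgramme` — ENGINE child gen 8 (stmt-HubbardSuperconductivity-20437 `KLRegimeEngineV17F2`), SKELETON v2 internal export class #5 «(S)-transfer»,
# TEXT REV 2 = the PINNED-WEIGHT family (plan g18 (R54), KL STATUS 2026-08-27T16:19:25Z; owner's word (β) KL STATUS 21:58:55Z)
# (cell gate-hubbard-kl, seat hubbard-kl-p1 g11 = class-#5 text owner; successor module of `…EngineV8PairTransferExport`, whose per-member layer it re-uses)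

WHY A SUCCESSOR MODULE WITH NEW NAMES.  (R54) (k3c1-p1 g9): with the transfer weight hidden behind `∃ t` in the carried history, the class-#5 producer — which
re-exports the member of index `m` at scale `n` BY COMPOSITION (`pairTransferFwd_succ_klPairArrayF`, composite weight `t_{n−1} + w − w₁^{(m)}` EXACTLY) — can bound the
new member's mass only by `bhi/4 + Σ|w − w₁^{(m)}|`, which drifts linearly in `n`; so the weight must be a NAMED model function whose mass / sign lines are MODEL LEMMAS
proved once, uniformly in `(n, member)`.  Two facts shape the revision: (F1) a landed `Theorems/` definition cannot be revised in place (gate: `theorems.append-only —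
deprecate-and-add under a new name`), so every definition whose meaning changes gets a new name here and rev 1 stays as the PER-MEMBER layer (`transferBarAt`,
`IsSoftSubCov`, `klCovSmearedPairAmplitude`, `PairTransferAtCov`, `PairTransferFamilyHard` and their lemmas keep their meaning and their consumers:
`…EnginePairLadderFamilyStep` p546910, `…EnginePairTransferBaseCore`, `…EngineScaleZeroTransfer(Gram)`); (F2) rev 1's `IsSoftSubCov` admits symbol fractions that are
spin-dependent or not even under `ν ↦ −ν`, for which the exact rung weight below is complex, so the real-weight clause cannot hold over that whole family:
rev 1's `PairTransferFamilyCov / PairTransferAt / PairTransferStep / klTransferPkg / klCT / klCTu` are RETIRED (superseded by the `…Pinned…` / `…2` names below;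
DefsU10's entry 6 re-keys to `klCTu2`).

* §1 SYMBOLS.  `IsSoftSymbol β μ K n φ` — `φ : FreqMomentum L M → ℝ` (spin-free by type), `0 ≤ φ ≤ 1 − w^K_{Λ_n}` pointwise, EVEN under `ν ↦ −ν`;
  `softCovOf β μ K φ := normalCovariance (φ·βL²·(iω + ξ_K)/nambuDen)` (rev 1's symbol shape: `isSoftSubCov_softCovOf`).  Members: `0` (`softSymbolZero`), the
  COMPLEMENTARY symbols `softSymbolCompl K n m = w^K_{Λ_m} − w^K_{Λ_n}` (`n ≤ m`; `softCovOf_compl = D^K_n − D^K_m`; `m = n` plain, `m` past the thermal scale Wick: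
  rev 1's `klSoftCov_sub_eq_self_of_lt`), and `1 − w^K_{Λ_n}` itself (`softCovOf_self = D^K_n`).
* §2 THE PINNED WEIGHT `klTransferWeight β μ K n φ Qm p := −(βL²)⁻¹ · Re Σ_ν [w^K_{Λ_n}(ν,p)·φ(−ν, Qm−p) + φ(ν,p)·w^K_{Λ_n}(−ν, Qm−p)]·ĝ_K(ν,p)·ĝ_K(−ν, Qm−p)`
  (`ĝ_K = propCT`): MINUS the aggregated mass, in the `z′` currency of `pairLadderStepAtV8_of_expansion` (`T_K = K(1 + diag z′K)⁻¹`, `z′ = (βL²)⁻³·λ`,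
  `vertexFn_dblFold_bubble_pairLabels`: line values `w·βL²·ĝ_K`), of the EXTRA rungs `H_n⊗S_φ + S_φ⊗H_n` that the member `𝒱₄(e^{Δ_{S_φ}}𝒱_n)` has over the plain
  `F_n` (`H_n = C^K_{>Λ_n}` hard, `S_φ = softCovOf φ`); rev 1's slot `1 − diag t·F` is the negative of the tree's `1 + diag z′·K`, so `t` is near-NONPOSITIVE deep inside
  (rev 1's sign line).  `Re` because realness for even `φ` is a model lemma (`ν ↦ −ν`), not a definitional fact.  At `n = 0` the SAME formula (`H₀ = C_{>Λ₀} ≠ 0`; (R54)(iv),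
  pen's default, no case split).  CONSERVATION IDENTITIES the composition uses (model lemmas, p1 lineage; bilinearity in the line symbols, `H_n = H_{n−1} + g_n`):
  `t_{n,m} = t_{n−1,m} + w − w₁^{(m)}` and `w = w₁^{(n)} − t_{n−1,n}` (`w = b[H_n] − b[H_{n−1}]` the plain slice mass, `w₁^{(φ)} = b[g_n] + 2·g_n⊗S_φ` the smeared one).
* §3 THE PINNED MEMBER / FAMILY: `PairTransferPinnedAt G P r β U μ n φ := ∀ Qm, IsPairClassAt L Qm n → ∃ Mt, (1 − diag (klTransferWeight … (K_n) n φ Qm)·klPairArrayF n Qm)·Mt = 1 ∧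
  ∀ k k′ ∈ klBall, ‖klCovSmearedPairAmplitude … (K_n) n (softCovOf … (K_n) φ) Qm k k′ − (klPairArrayF n Qm·Mt) k k′‖ ≤ transferBarAt … n Qm k k′` (bar UNCHANGED);
  `PairTransferPinnedFamily … n := ∀ φ, IsSoftSymbol … (K_n) n φ → PairTransferPinnedAt … n φ`; the BRIDGE to rev 1's per-member text
  `pairTransferAtCov_of_pinned : (mass line) → (sign line) → PairTransferPinnedAt … n φ → PairTransferAtCov … n (softCovOf φ)` (so p546910 is fed through it, untouched);
  `PairTransferPinnedFamily.hard_of_lines` (rev 1's `PairTransferFamilyHard` from the pinned family and the two model lines); monotonicity in `r`.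
* §4 THE STEP PROP `PairTransferStep2 P R Q₀ r u` (rev 1's binders VERBATIM; history `∀ j < n, PairTransferPinnedFamily … j`, conclusion `PairTransferPinnedFamily … n`),
  the deferred package `klTransferPkg2 / klCT2 / klCTu2` (`klCT2_nonneg`, `klCTu2_pos`, `pairTransferStep2_klCT2_of_exists/_of`), and the UNROLL twin
  `pairTransferPinnedFamily_all_of_step2` (`…EngineV8ExportUnroll`'s pattern and bookkeeping lemmas).
Definitions with bodies + bookkeeping lemmas; nothing about the model is asserted (the member relation, the model lines and the identities are obligations of the
class-#5 producer / the EdgeFacts lane); nothing asserts superconductivity.  0 kit.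
-/

noncomputable section

namespace Summit.HubbardSuperconductivity.HubbardSuperconductivity.Theorems.KLRegimeSplit

set_option linter.dupNamespace false -- summit = problem name (single-conjunct summit), D-0017

open Real Finset Literature.MathematicalPhysics.QuantumLattice Literature.Probability.LatticeModels
open Literature.MathematicalPhysics.QuantumLattice.FermiRG
open Summit.HubbardSuperconductivity.HubbardSuperconductivity.Theorems.KLProgrammeLegKernels
open Summit.HubbardSuperconductivity.HubbardSuperconductivity.Theorems.TwoPointAssembly
open Summit.HubbardSuperconductivity.HubbardSuperconductivity.Theorems.KLRegimeWick
open Summit.HubbardSuperconductivity.HubbardSuperconductivity.Theorems.EngineV8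
open Summit.HubbardSuperconductivity.HubbardSuperconductivity.Theorems.DispersionFlow

/-! ## §1 Admissible symbols and their covariances -/

section Symbols

variable (L M : ℕ) [NeZero L] [NeZero M]

/-- **Admissible smearing SYMBOLS at frame `K`, scale `n`**: spin-free real fractions `φ ∈ [0, 1 − w^K_{Λ_n}]` of the zero-seed propagator symbol that are EVEN under the
frequency flip `ν ↦ −ν` (so that every Matsubara-summed pair weight built from them is real). -/
def IsSoftSymbol (β μ : ℝ) (K : TrigPolyC4v) (n : ℕ) (φ : FreqMomentum L M → ℝ) : Prop :=
  (∀ k, 0 ≤ φ k ∧ φ k ≤ 1 - hubbardCutoffWeightCT L M β μ K (klScale klE0 n) k) ∧ ∀ k : FreqMomentum L M, φ (k.1.rev, k.2) = φ k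

/-- **The smearing covariance of a symbol**: `softCovOf β μ K φ = normalCovariance (φ·βL²·(iω + ξ_K)/nambuDen)` (rev 1's symbol shape, `klw_softCov_eq_normalCovariance`). -/
def softCovOf (β μ : ℝ) (K : TrigPolyC4v) (φ : FreqMomentum L M → ℝ) : Matrix (HubbardFieldIdx L M) (HubbardFieldIdx L M) ℂ :=
  normalCovariance L M (fun ks => (φ ks.1 : ℂ) *
    (((β * (L : ℝ) ^ 2 : ℝ) : ℂ) * ((Complex.I * matsubaraFreq β M ks.1.1 + nambuXiCT L μ K ks.1.2) / nambuDenCT L M β μ 0 K ks.1)))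

/-- **The complementary symbol of index `m` at scale `n`**: `w^K_{Λ_m} − w^K_{Λ_n}` (the covariance `D^K_n − D^K_m = C^K_{(Λ_m, Λ_n]}`, `softCovOf_compl`). -/
def softSymbolCompl (β μ : ℝ) (K : TrigPolyC4v) (n m : ℕ) (k : FreqMomentum L M) : ℝ :=
  hubbardCutoffWeightCT L M β μ K (klScale klE0 m) k - hubbardCutoffWeightCT L M β μ K (klScale klE0 n) k

variable {L M}

omit [NeZero L] [NeZero M] in
/-- An admissible symbol gives an admissible smearing covariance in rev 1's sense (`IsSoftSubCov`). -/
theorem isSoftSubCov_softCovOf {β μ : ℝ} {K : TrigPolyC4v} {n : ℕ} {φ : FreqMomentum L M → ℝ} (h : IsSoftSymbol L M β μ K n φ) :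
    IsSoftSubCov L M β μ K n (softCovOf L M β μ K φ) :=
  ⟨fun ks => φ ks.1, fun ks => h.1 ks.1, rfl⟩

omit [NeZero L] [NeZero M] in
/-- The zero symbol is admissible … -/
theorem isSoftSymbol_zero (β μ : ℝ) (K : TrigPolyC4v) (n : ℕ) : IsSoftSymbol L M β μ K n (fun _ => 0) := by
  refine ⟨fun k => ⟨le_rfl, ?_⟩, fun _ => rfl⟩
  have h : hubbardCutoffWeightCT L M β μ K (klScale klE0 n) k ≤ 1 := (salmhoferCutoff_mem_Icc _).2
  linarith

omit [NeZero L] [NeZero M] in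
/-- … and its covariance is `0` (the PLAIN member, `klCovSmearedPairAmplitude_zero`). -/
theorem softCovOf_zero (β μ : ℝ) (K : TrigPolyC4v) : softCovOf L M β μ K (fun _ => 0) = 0 := by
  ext X Y
  simp [softCovOf, normalCovariance_apply]

omit [NeZero L] [NeZero M] in
/-- The weight above scale is antitone in the scale index: `w^K_{Λ_n} ≤ w^K_{Λ_m}` for `n ≤ m` (`Λ_m ≤ Λ_n`). -/
theorem hubbardCutoffWeightCT_klScale_mono (β μ : ℝ) (K : TrigPolyC4v) {n m : ℕ} (hnm : n ≤ m) (k : FreqMomentum L M) :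
    hubbardCutoffWeightCT L M β μ K (klScale klE0 n) k ≤ hubbardCutoffWeightCT L M β μ K (klScale klE0 m) k := by
  have hE0 : (0 : ℝ) ≤ klE0 := by
    have h0 := klth_klScale_pos 0
    unfold klScale at h0
    simpa using h0.le
  have hΛ : klScale klE0 m ≤ klScale klE0 n := by
    unfold klScale
    exact mul_le_mul_of_nonneg_left (inv_anti₀ (by positivity) (pow_le_pow_right₀ (by norm_num) hnm)) hE0
  unfold hubbardCutoffWeightCT
  refine monotone_salmhoferCutoff ?_
  have hE : 0 ≤ matsubaraFreq β M k.1 ^ 2 + nambuXiCT L μ K k.2 ^ 2 := by positivity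
  exact div_le_div_of_nonneg_left hE (by have := klth_klScale_pos m; positivity) (pow_le_pow_left₀ (klth_klScale_pos m).le hΛ 2)

omit [NeZero L] [NeZero M] in
/-- **Every complementary symbol is admissible** (`n ≤ m`): `0 ≤ w_{Λ_m} − w_{Λ_n} ≤ 1 − w_{Λ_n}`, even in the frequency (`hubbardCutoffWeightCT_revFreq`). -/
theorem isSoftSymbol_compl (β μ : ℝ) (K : TrigPolyC4v) {n m : ℕ} (hnm : n ≤ m) : IsSoftSymbol L M β μ K n (softSymbolCompl L M β μ K n m) := by
  refine ⟨fun k => ⟨?_, ?_⟩, fun k => ?_⟩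
  · have := hubbardCutoffWeightCT_klScale_mono (L := L) β μ K hnm k
    unfold softSymbolCompl; linarith
  · have h : hubbardCutoffWeightCT L M β μ K (klScale klE0 m) k ≤ 1 := (salmhoferCutoff_mem_Icc _).2
    unfold softSymbolCompl; linarith
  · unfold softSymbolCompl
    rw [hubbardCutoffWeightCT_revFreq, hubbardCutoffWeightCT_revFreq]

omit [NeZero M] in
/-- **The complementary symbol's covariance is `D^K_n − D^K_m`.** -/
theorem softCovOf_compl (β μ : ℝ) (K : TrigPolyC4v) (n m : ℕ) :
    softCovOf L M β μ K (softSymbolCompl L M β μ K n m) = klSoftCov L M β μ K n - klSoftCov L M β μ K m := by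
  rw [klw_softCov_eq_normalCovariance, klw_softCov_eq_normalCovariance, ← normalCovariance_sub_symbol, softCovOf]
  congr 1
  funext ks
  unfold softSymbolCompl
  push_cast
  ring

omit [NeZero L] [NeZero M] in
/-- The symbol `1 − w^K_{Λ_n}` is admissible at scale `n` … -/
theorem isSoftSymbol_self (β μ : ℝ) (K : TrigPolyC4v) (n : ℕ) :
    IsSoftSymbol L M β μ K n (fun k => 1 - hubbardCutoffWeightCT L M β μ K (klScale klE0 n) k) := by
  refine ⟨fun k => ⟨?_, le_rfl⟩, fun k => ?_⟩
  · have h : hubbardCutoffWeightCT L M β μ K (klScale klE0 n) k ≤ 1 := (salmhoferCutoff_mem_Icc _).2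
    linarith
  · simp only [hubbardCutoffWeightCT_revFreq]

omit [NeZero M] in
/-- … and its covariance is `D^K_n` itself (the WICK member, `klCovSmearedPairAmplitude_klSoftCov_self`). -/
theorem softCovOf_self (β μ : ℝ) (K : TrigPolyC4v) (n : ℕ) :
    softCovOf L M β μ K (fun k => 1 - hubbardCutoffWeightCT L M β μ K (klScale klE0 n) k) = klSoftCov L M β μ K n := by
  rw [klw_softCov_eq_normalCovariance, softCovOf]
  congr 1
  funext ks
  push_cast
  ring

end Symbols

/-! ## §2 The pinned transfer weight -/

section Weight

variable (L M : ℕ)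

/-- **The pinned transfer weight** of the member `φ` at scale `n`, pair class `Qm`, label `p`:
`klTransferWeight β μ K n φ Qm p = −(βL²)⁻¹ · Re Σ_ν [w^K_{Λ_n}(ν,p)·φ(−ν, Qm−p) + φ(ν,p)·w^K_{Λ_n}(−ν, Qm−p)]·ĝ_K(ν,p)·ĝ_K(−ν, Qm−p)` — minus the Matsubara-summed
mixed bubble `2·H_n⊗S_φ` at the pair labels (hard line `w^K_{Λ_n}·ĝ_K`, soft line `φ·ĝ_K`), in the `1 − diag t·F` slot of `PairTransferAtCov`. -/
def klTransferWeight (β μ : ℝ) (K : TrigPolyC4v) (n : ℕ) (φ : FreqMomentum L M → ℝ) (Qm p : TorusSite 2 L) : ℝ :=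
  -((β * (L : ℝ) ^ 2)⁻¹ *
    (∑ ν : MatsubaraIdx M,
      (((hubbardCutoffWeightCT L M β μ K (klScale klE0 n) (ν, p) * φ (ν.rev, Qm - p) +
          φ (ν, p) * hubbardCutoffWeightCT L M β μ K (klScale klE0 n) (ν.rev, Qm - p) : ℝ) : ℂ) *
        (propCT L M β μ K (ν, p) * propCT L M β μ K (ν.rev, Qm - p)))).re)

variable {L M}

/-- Unfolding `klTransferWeight`. -/
theorem klTransferWeight_def (β μ : ℝ) (K : TrigPolyC4v) (n : ℕ) (φ : FreqMomentum L M → ℝ) (Qm p : TorusSite 2 L) :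
    klTransferWeight L M β μ K n φ Qm p =
      -((β * (L : ℝ) ^ 2)⁻¹ *
        (∑ ν : MatsubaraIdx M,
          (((hubbardCutoffWeightCT L M β μ K (klScale klE0 n) (ν, p) * φ (ν.rev, Qm - p) +
              φ (ν, p) * hubbardCutoffWeightCT L M β μ K (klScale klE0 n) (ν.rev, Qm - p) : ℝ) : ℂ) *
            (propCT L M β μ K (ν, p) * propCT L M β μ K (ν.rev, Qm - p)))).re) := rfl

/-- The PLAIN member carries no transfer weight: `klTransferWeight … n 0 = 0`. -/
theorem klTransferWeight_zero_symbol (β μ : ℝ) (K : TrigPolyC4v) (n : ℕ) (Qm p : TorusSite 2 L) :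
    klTransferWeight L M β μ K n (fun _ => 0) Qm p = 0 := by
  simp [klTransferWeight]

end Weight

/-! ## §3 The pinned member clause, the pinned family, the bridge to rev 1's per-member text -/

section Model

variable (L M : ℕ) [NeZero L] [NeZero M]

/-- **`PairTransferPinnedAt L M G P r β U μ n φ`** — the transfer clause of the member `φ` with the PINNED weight: for every pair class `Qm` at resolution `n`, a right inverse
`Mt` of `1 − diag (klTransferWeight … (K_n) n φ Qm)·klPairArrayF n Qm` and ON THE BARE BALL
`‖𝒱₄(e^{Δ_{S_φ}}𝒱_n[K_n])(Qm;k,k′) − (klPairArrayF n Qm·Mt) k k′‖ ≤ transferBarAt … n Qm k k′` (`S_φ = softCovOf … (K_n) φ`; bar as in rev 1). -/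
def PairTransferPinnedAt (G : GeoConsts) (P : SplitConsts) (r β U μ : ℝ) (n : ℕ) (φ : FreqMomentum L M → ℝ) : Prop :=
  ∀ Qm : TorusSite 2 L, IsPairClassAt L Qm n →
    ∃ Mt : Matrix (TorusSite 2 L) (TorusSite 2 L) ℂ,
      (1 - Matrix.diagonal (fun p => (klTransferWeight L M β μ (klFlowFrameU L M β U μ n) n φ Qm p : ℂ)) * klPairArrayF L M β U μ n Qm) * Mt = 1 ∧
      ∀ k ∈ klBall L μ 0, ∀ k' ∈ klBall L μ 0,
        ‖klCovSmearedPairAmplitude L M β U μ (klFlowFrameU L M β U μ n) n (softCovOf L M β μ (klFlowFrameU L M β U μ n) φ) Qm k k' -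
            (klPairArrayF L M β U μ n Qm * Mt) k k'‖ ≤
          transferBarAt L G P r β U n Qm k k'

/-- **`PairTransferPinnedFamily L M G P r β U μ n`** := the pinned clause at EVERY admissible symbol of the frame `K_n` at scale `n` — the invariant class #5's one-slice
induction carries (rev 2; contains the plain member, the Wick member and every complementary member). -/
def PairTransferPinnedFamily (G : GeoConsts) (P : SplitConsts) (r β U μ : ℝ) (n : ℕ) : Prop :=
  ∀ φ : FreqMomentum L M → ℝ, IsSoftSymbol L M β μ (klFlowFrameU L M β U μ n) n φ → PairTransferPinnedAt L M G P r β U μ n φ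

variable {L M}

/-- **BRIDGE to rev 1's per-member text**: the pinned clause plus the two MODEL LINES of the pinned weight (mass `≤ G.bhi/4`, near-nonpositivity `≤ klEdge G n |Qm|_𝕋`)
give `PairTransferAtCov … n (softCovOf φ)` — with `t := klTransferWeight …`.  (This is how `pairLadderStepAtV17F2_of_pairTransferAtCov`, p546910, is fed.) -/
theorem pairTransferAtCov_of_pinned {G : GeoConsts} {P : SplitConsts} {r β U μ : ℝ} {n : ℕ} {φ : FreqMomentum L M → ℝ}
    (hmass : ∀ Qm : TorusSite 2 L, IsPairClassAt L Qm n → ∑ p, |klTransferWeight L M β μ (klFlowFrameU L M β U μ n) n φ Qm p| ≤ G.bhi / 4)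
    (hsign : ∀ Qm : TorusSite 2 L, IsPairClassAt L Qm n →
      ∑ p, (|klTransferWeight L M β μ (klFlowFrameU L M β U μ n) n φ Qm p| + klTransferWeight L M β μ (klFlowFrameU L M β U μ n) n φ Qm p) ≤
        klEdge G n (klTorusNorm L Qm))
    (h : PairTransferPinnedAt L M G P r β U μ n φ) :
    PairTransferAtCov L M G P r β U μ n (softCovOf L M β μ (klFlowFrameU L M β U μ n) φ) :=
  fun Qm hQm => ⟨_, hmass Qm hQm, hsign Qm hQm, h Qm hQm⟩

/-- **Rev 1's complementary family from the pinned family and the model lines** (at the complementary symbols). -/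
theorem PairTransferPinnedFamily.hard_of_lines {G : GeoConsts} {P : SplitConsts} {r β U μ : ℝ} {n : ℕ} (h : PairTransferPinnedFamily L M G P r β U μ n)
    (hmass : ∀ m, n ≤ m → ∀ Qm : TorusSite 2 L, IsPairClassAt L Qm n →
      ∑ p, |klTransferWeight L M β μ (klFlowFrameU L M β U μ n) n (softSymbolCompl L M β μ (klFlowFrameU L M β U μ n) n m) Qm p| ≤ G.bhi / 4)
    (hsign : ∀ m, n ≤ m → ∀ Qm : TorusSite 2 L, IsPairClassAt L Qm n →
      ∑ p, (|klTransferWeight L M β μ (klFlowFrameU L M β U μ n) n (softSymbolCompl L M β μ (klFlowFrameU L M β U μ n) n m) Qm p| +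
          klTransferWeight L M β μ (klFlowFrameU L M β U μ n) n (softSymbolCompl L M β μ (klFlowFrameU L M β U μ n) n m) Qm p) ≤
        klEdge G n (klTorusNorm L Qm)) :
    PairTransferFamilyHard L M G P r β U μ n := by
  intro m hm
  rw [← softCovOf_compl]
  exact pairTransferAtCov_of_pinned (hmass m hm) (hsign m hm) (h _ (isSoftSymbol_compl β μ _ hm))

/-- The pinned family contains the PLAIN member's clause with weight `0` and `Mt` a right inverse of `1`: i.e. it asserts, at `φ = 0`,
`‖𝒞_n(Qm;k,k′) − (klPairArrayF n Qm·Mt) k k′‖ ≤ transferBarAt …` for some `Mt` with `1·Mt = 1` — recorded as the unfolding below (a consistency check of the text). -/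
theorem PairTransferPinnedFamily.plain {G : GeoConsts} {P : SplitConsts} {r β U μ : ℝ} {n : ℕ} (h : PairTransferPinnedFamily L M G P r β U μ n)
    {Qm : TorusSite 2 L} (hQm : IsPairClassAt L Qm n) :
    ∃ Mt : Matrix (TorusSite 2 L) (TorusSite 2 L) ℂ, Mt = 1 ∧
      ∀ k ∈ klBall L μ 0, ∀ k' ∈ klBall L μ 0,
        ‖klPairAmplitude L M β U μ (klFlowFrameU L M β U μ n) n Qm k k' - (klPairArrayF L M β U μ n Qm * Mt) k k'‖ ≤ transferBarAt L G P r β U n Qm k k' := by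
  obtain ⟨Mt, hM, hbd⟩ := h _ (isSoftSymbol_zero β μ _ n) Qm hQm
  have hM1 : Mt = 1 := by
    have : (1 - Matrix.diagonal (fun p => (klTransferWeight L M β μ (klFlowFrameU L M β U μ n) n (fun _ => 0) Qm p : ℂ)) *
        klPairArrayF L M β U μ n Qm) = 1 := by
      simp [klTransferWeight_zero_symbol]
    rw [this, Matrix.one_mul] at hM
    exact hM
  refine ⟨Mt, hM1, fun k hk k' hk' => ?_⟩
  have := hbd k hk k' hk'
  rwa [softCovOf_zero, klCovSmearedPairAmplitude_zero] at this

/-- The pinned family contains the WICK member (`φ = 1 − w^{K_n}_{Λ_n}`, covariance `D^{K_n}_n` by `softCovOf_self`) … -/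
theorem PairTransferPinnedFamily.self {G : GeoConsts} {P : SplitConsts} {r β U μ : ℝ} {n : ℕ} (h : PairTransferPinnedFamily L M G P r β U μ n) :
    PairTransferPinnedAt L M G P r β U μ n
      (fun k => 1 - hubbardCutoffWeightCT L M β μ (klFlowFrameU L M β U μ n) (klScale klE0 n) k) :=
  h _ (isSoftSymbol_self β μ _ n)

/-- … and every COMPLEMENTARY member (`n ≤ m`, covariance `D^{K_n}_n − D^{K_n}_m` by `softCovOf_compl`) — the minimal sub-family the step towers consume. -/
theorem PairTransferPinnedFamily.compl {G : GeoConsts} {P : SplitConsts} {r β U μ : ℝ} {n m : ℕ} (h : PairTransferPinnedFamily L M G P r β U μ n)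
    (hm : n ≤ m) : PairTransferPinnedAt L M G P r β U μ n (softSymbolCompl L M β μ (klFlowFrameU L M β U μ n) n m) :=
  h _ (isSoftSymbol_compl β μ _ hm)

/-- Monotonicity of the pinned clause in `r`. -/
theorem PairTransferPinnedAt.mono {G : GeoConsts} (hph : ∀ n ρ, 0 ≤ G.phGain n ρ) (hCF : 0 ≤ G.CF) {P : SplitConsts} (hK : 0 ≤ P.Klam) {r r' β U μ : ℝ}
    {n : ℕ} {φ : FreqMomentum L M → ℝ} (h : PairTransferPinnedAt L M G P r β U μ n φ) (hr : r ≤ r') :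
    PairTransferPinnedAt L M G P r' β U μ n φ := by
  intro Qm hQm
  obtain ⟨Mt, hM, hbd⟩ := h Qm hQm
  exact ⟨Mt, hM, fun k hk k' hk' => (hbd k hk k' hk').trans (transferBarAt_mono hph hCF hK hr β U n Qm k k')⟩

/-- Monotonicity of the pinned family in `r`. -/
theorem PairTransferPinnedFamily.mono {G : GeoConsts} (hph : ∀ n ρ, 0 ≤ G.phGain n ρ) (hCF : 0 ≤ G.CF) {P : SplitConsts} (hK : 0 ≤ P.Klam) {r r' β U μ : ℝ}
    {n : ℕ} (h : PairTransferPinnedFamily L M G P r β U μ n) (hr : r ≤ r') : PairTransferPinnedFamily L M G P r' β U μ n :=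
  fun φ hφ => (h φ hφ).mono hph hCF hK hr

end Model

/-! ## §4 The step Prop (rev 2), the deferred package, the unroll -/

/-- **`PairTransferStep2 P R Q₀ r u`** — class #5's induction step, rev 2: rev 1's binders VERBATIM (`G.WF`, the raised `CR`-value `rr ≥ Q₀.CR`, the engine-flow doors
`klEngC₃6`, `klEngU₀9`, `klEngL₃`, `klEngM₃`, the step's own threshold `u rr cc`, the history at `Q₀.withCR rr`, the admissibility of `K_n`, class #1's exports at the
deferred table `klCU P R Q₀` at every `j ≤ n`) with the PINNED transfer history `∀ j < n, PairTransferPinnedFamily … j` ⟹ `PairTransferPinnedFamily … n`.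
(At `n = 0` the transfer history is empty: the scale-`0` member clauses are the scale-`0` lane's base, keyed to `klTransferWeight … 0 φ`.) -/
def PairTransferStep2 (P : SplitConsts) (R : RenConsts) (Q₀ : EngConsts) (r : ℝ) (u : ℝ → ℝ → ℝ) : Prop :=
  ∀ G : GeoConsts, G.WF → ∀ rr : ℝ, Q₀.CR ≤ rr →
    ∀ cc : ℝ, 0 < cc → cc ≤ klEngC₃6 P R →
      ∀ μ ∈ klWindowC, ∀ U : ℝ, 0 < U → U ≤ klEngU₀9 P R cc → U ≤ u rr cc →
        ∀ β : ℝ, klBetaMin ≤ β → β ≤ Real.exp (cc / U ^ 2) →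
          ∀ (L M : ℕ) [NeZero L] [NeZero M], klEngL₃ β U ≤ L → klEngM₃ β U L ≤ M →
            ∀ n : ℕ, n ≤ nScales β + 1 → IsKLRegime U cc (-(n : ℤ)) →
              HistP klPredsV17F2 L M G P (Q₀.withCR rr) R β U μ 0 n →
                FrameOK R U (nScales β) μ (klFlowFrameU L M β U μ n) →
                  (∀ j ≤ n, LevelsUExportAt L M (klCU P R Q₀) P β U μ j) →
                    (∀ j < n, PairTransferPinnedFamily L M G P r β U μ j) →
                      PairTransferPinnedFamily L M G P r β U μ n

section Deferred

variable (P : SplitConsts) (R : RenConsts) (Q₀ : EngConsts)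

/-- The deferred transfer package, rev 2: SOME admissible `(r, u)` for which `PairTransferStep2` holds, if one exists, else the trivial package. -/
def klTransferPkg2 : ℝ × (ℝ → ℝ → ℝ) :=
  open scoped Classical in
  if h : ∃ e : ℝ × (ℝ → ℝ → ℝ), IsTransferPkg e ∧ PairTransferStep2 P R Q₀ e.1 e.2 then Classical.choose h else (0, fun _ _ => 1)

/-- **The deferred transfer constant `klCT2 P R Q₀`** (rev 2) — a closed term today, adequate the day `PairTransferStep2 P R Q₀ r u` is proved for an admissible package
(`pairTransferStep2_klCT2_of_exists`). -/
def klCT2 : ℝ := (klTransferPkg2 P R Q₀).1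

/-- **The deferred coupling threshold `klCTu2 P R Q₀ rr cc`** (rev 2; the v2 U-door entry 6 re-keys to it). -/
def klCTu2 : ℝ → ℝ → ℝ := (klTransferPkg2 P R Q₀).2

/-- The deferred package is admissible (unconditionally). -/
theorem isTransferPkg_klTransferPkg2 : IsTransferPkg (klTransferPkg2 P R Q₀) := by
  classical
  unfold klTransferPkg2
  split_ifs with h
  · exact (Classical.choose_spec h).1
  · exact isTransferPkg_zero

/-- `0 ≤ klCT2 P R Q₀` (unconditionally). -/
theorem klCT2_nonneg : 0 ≤ klCT2 P R Q₀ := (isTransferPkg_klTransferPkg2 P R Q₀).1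

/-- `0 < klCTu2 P R Q₀ rr cc` (unconditionally) — so a `min` with it keeps a U-door positive. -/
theorem klCTu2_pos (rr cc : ℝ) : 0 < klCTu2 P R Q₀ rr cc := (isTransferPkg_klTransferPkg2 P R Q₀).2 rr cc

variable {P R Q₀}

/-- **The step holds for the deferred package as soon as it holds for some admissible package.** -/
theorem pairTransferStep2_klCT2_of_exists (h : ∃ e : ℝ × (ℝ → ℝ → ℝ), IsTransferPkg e ∧ PairTransferStep2 P R Q₀ e.1 e.2) :
    PairTransferStep2 P R Q₀ (klCT2 P R Q₀) (klCTu2 P R Q₀) := by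
  classical
  have hpkg : klTransferPkg2 P R Q₀ = Classical.choose h := by
    unfold klTransferPkg2
    rw [dif_pos h]
  unfold klCT2 klCTu2
  rw [hpkg]
  exact (Classical.choose_spec h).2

/-- Packaging an explicit witness. -/
theorem pairTransferStep2_klCT2_of {r : ℝ} {u : ℝ → ℝ → ℝ} (hr : 0 ≤ r) (hu : ∀ rr cc, 0 < u rr cc) (hs : PairTransferStep2 P R Q₀ r u) :
    PairTransferStep2 P R Q₀ (klCT2 P R Q₀) (klCTu2 P R Q₀) :=
  pairTransferStep2_klCT2_of_exists ⟨(r, u), ⟨hr, hu⟩, hs⟩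

end Deferred

section Unroll

variable {L M : ℕ} [NeZero L] [NeZero M] {G : GeoConsts} {P : SplitConsts} {Q₀ : EngConsts} {R : RenConsts} {β U μ r cc : ℝ}

/-- **CLASS #5 (rev 2) UNROLLED**: from `PairTransferStep2 P R Q₀ rT u`, the binders, the public history up to `n ≤ n_β + 1` AND the class-#1 exports at the deferred table
`klCU P R Q₀` at every `j ≤ n`, the pinned family at EVERY `j ≤ n` (`…EngineV8ExportUnroll`'s pattern). -/
theorem pairTransferPinnedFamily_all_of_step2 {rT : ℝ} {u : ℝ → ℝ → ℝ} (hstep : PairTransferStep2 P R Q₀ rT u) (hG : G.WF) (hr : Q₀.CR ≤ r)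
    (hcc0 : 0 < cc) (hcc : cc ≤ klEngC₃6 P R) (hμ : μ ∈ klWindowC) (h0 : FrameOK R U (nScales β) μ 0) (hU : 0 < U) (hU9 : U ≤ klEngU₀9 P R cc) (hUu : U ≤ u r cc)
    (hβ : klBetaMin ≤ β) (hβc : β ≤ Real.exp (cc / U ^ 2)) (hL : klEngL₃ β U ≤ L) (hM : klEngM₃ β U L ≤ M) (hR : R.WF2)
    {n : ℕ} (hn : n ≤ nScales β + 1) (hhist : HistP klPredsV17F2 L M G P (Q₀.withCR r) R β U μ 0 n)
    (hlev : ∀ j ≤ n, LevelsUExportAt L M (klCU P R Q₀) P β U μ j) :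
    ∀ j ≤ n, PairTransferPinnedFamily L M G P rT β U μ j := by
  intro j
  induction j using Nat.strong_induction_on with
  | _ j ih =>
    intro hj
    have hjn : j ≤ nScales β + 1 := hj.trans hn
    have hhj := histP_klPredsV17F2_of_le hhist hj
    exact hstep G hG r hr cc hcc0 hcc μ hμ U hU hU9 hUu β hβ hβc L M hL hM j hjn (isKLRegime_of_le_nScales_succ hcc0.le hβ hβc hjn)
      hhj (frameOK_klFlowFrameU_of_histP hR h0 hjn hhj) (fun i hi => hlev i (hi.trans hj)) (fun i hi => ih i hi (by omega))

end Unroll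

end Summit.HubbardSuperconductivity.HubbardSuperconductivity.Theorems.KLRegimeSplit

end
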